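import Literature.Geometry.Kaehler.ComplexTorusCyclotomicAutomorphismOrderNine
import Literature.Geometry.Kaehler.ComplexTorusCyclotomicAutomorphismHodgeConjecturePowers
import Literature.Geometry.Kaehler.ComplexTorusCyclotomicAutomorphismFiniteOrderEndomorphismsCount
import Literature.Geometry.Kaehler.ComplexTorusStablyNondegenerateProducts
import Literature.NumberTheory.ComplexMultiplication.CMAlgebraTorusMumfordTateTorus
import Literature.NumberTheory.ComplexMultiplication.CMTypeTorusAbelianVariety
import HarnessLib

/-!
# The Mumford–Tate group of `ℂ^Φ/Φ(𝔞)` is a torus for EVERY CM type; every complex torus with an endomorphism of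
# characteristic polynomial `Φ_d` has a Mumford–Tate torus; the `ζ_7`- and `ζ_9`-threefolds: Hodge classes on all
# powers are divisor classes, `rank MT = 4` and `Aut_tors = ±u^r` for the simple ones

Layer `Literature/Geometry/Kaehler`, namespace `Literature.Geometry.Kaehler.ComplexTorus`; lane `lit-hodgefound`
(Track 2 foundations library), Layer A2/A3 junction, row «A2-26(gj)» (self-proposed 2026-08-28, prover seat
`lit-hodgefound-p10`, generation 32, FILE 6 of the generation).  Theorems only; no `def`, no instance, no named
fact (net Literature debt 0).

§1.  Generation 31 FILE 13 proved «`MT(X)(ℂ)` is an algebraic torus» for `(X, u) ≅ (ℂ^Φ/Φ(𝔞), ζ_d)` with the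
MODEL SIMPLE (`Φ` primitive: `End_ℚ(X) ≅ ℚ(ζ_d)` is then a field of full degree).  The hypothesis is superfluous:
`ℂ^Φ/Φ(𝔞)` is, for every CM type `Φ` of any CM field `K` and every fractional ideal `𝔞`, a complex torus with
`K`-multiplication of full degree (`CMTypeLattice.isCMTorusRat_periodIso`, Shimura's THEOREM 2 read backwards), i.e.
one with multiplication by the one-factor CM-algebra `K` (Milne's Definition 14.9, `IsCMAlgTorusRat.of_isCMTorusRat`),
and for those the tree has Deligne's / Milne's «of CM-type ⟹ `MT` is a torus»
(`IsCMAlgTorusRat.isTorusSubgroup_mumfordTateGroupC`).  Hence `isTorusSubgroup_mumfordTateGroupC_periodIso` — and,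
since «`MT` is a torus» is an isogeny invariant of abelian varieties (`IsIsogenous.exists_comm_isReduced_le_endAlgRat_iff`
with `IsAbelianVariety.isTorusSubgroup_mumfordTateGroupC_iff`) and `X ≅ ℂ^Φ/Φ(𝔞)` by the structure theorem (FILE 1),
**every complex torus with an endomorphism of characteristic polynomial `Φ_d` has an algebraic torus as Mumford–Tate
group and a commutative Hodge group** (`isTorusSubgroup_mumfordTateGroupC_of_charpoly_eq_cyclotomic`,
`hodgeGroupC_comm_of_charpoly_eq_cyclotomic`; order form `…_of_orderOf_eq` for `u` of prime-power order `q` on a torus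
of dimension `φ(q)/2`, FILE 2).

§2–§3.  The `ζ_7`-threefolds and the `ζ_9`-threefolds (`3`-dimensional complex tori with an endomorphism `u` of order
`7`, resp. `9`; generation 32 FILES 4, 5: `(X, u) ≅ (ℂ³/Φ(𝔞), ζ)`, `X` simple iff `Φ` primitive, otherwise `X ∼ E³`
with `E` a CM elliptic curve of `ℚ(√−7)`, resp. `ℚ(√−3)`):
* `MT(X)` is a torus and `Hg(X)` is commutative for ALL of them (§1);
* **`Hdg(X^k) = Div(X^k)` for all `k`, for ALL of them** — the simple ones are simple CM abelian varieties of PRIME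
  dimension `3` (Tankeev–Ribet / Yanai, FILE 14 `divisorClasses_powPeriod_eq_hodgeClasses_of_iso_of_prime`, or
  Moonen–Zarhin's `dim ≤ 3`), the non-simple ones are isogenous to `E³`, and «`Hdg = Div` on all powers» is an
  isogeny invariant that passes between `Y` and `Y³` (`forall_powPeriod_divisorClasses_eq_hodgeClasses_iff_of_isIsogenous_powPeriod`)
  and holds for the CM elliptic curve `E` (Moonen–Zarhin, simple of CM type of dimension `≤ 3`:
  `IsAbelianVariety.divisorClasses_powPeriod_eq_hodgeClasses_of_isSimple_of_card_le_six_of_isTorusSubgroup_mumfordTateGroupC`);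
* for the SIMPLE ones: `rank MT(X) = 4 = dim X + 1` (Yanai: nondegenerate), and the finite-order endomorphisms are
  exactly the `14` (resp. `18`) maps `±u^r` (FILES 10, 11; `d` odd), so their orders divide `14` (resp. `18`).

## What is NOT here

* `rank MT(X) = 2` for the non-simple threefolds (`MT(X) = MT(E)`): the tree's rank-of-powers statements are phrased
  for the `periodEquiv` models (`CMTorusProductsMumfordTateRank`); not threaded here.
* The finite-order endomorphisms of the NON-simple threefolds (`End_ℚ(X) ≅ M₃(K₀)` has many more than `±u^r`).

## References

* [Deligne1982HodgeCycles] P. Deligne, *Hodge cycles on abelian varieties*, LNM 900 (1982), I §5 («of CM-type»,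
  Prop. 5.1).
* [Milne2005ShimuraVarieties] J. S. Milne, *Introduction to Shimura Varieties* (2005), §14 Def. 14.9, Prop. 14.10.
* [Gordon1997] B. B. Gordon, *A survey of the Hodge conjecture for abelian varieties* (1997/1999), §2 Prop. 2.12.
* [Gordon1999HodgeAVSurvey] — idem, Thm. 6.3 (2) and Remark, 7.6, 9.3.
* [MoonenZarhin1999LowDim] B. Moonen, Yu. Zarhin, *Hodge classes on abelian varieties of low dimension*,
  Math. Ann. 315 (1999), Thm. 0.1 (4), (0.2)(4), §1.
* [Yanai1985] H. Yanai, *On degenerate CM-types*, §4 Theorem (p. 171).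
* [Shimura1998] G. Shimura, *Abelian Varieties with Complex Multiplication and Modular Functions* (1998), §5.1
  Prop. 6 p. 37, §6.1 Thm. 2 p. 41, §6.2 Thm. 3 p. 42, §8.2 Prop. 26 p. 69.
* [BirkenhakeLange2004] Ch. Birkenhake, H. Lange, *Complex Abelian Varieties*, 2nd ed. (2004), §13.3, §17.3.
* [Lange2023AbelianVarietiesComplex] H. Lange, *Abelian Varieties over the Complex Numbers* (2023), §7.2.3
  Prop. 7.2.6, §7.3.3 Exercise (1).
-/

noncomputable section

open scoped Classical nonZeroDivisors NumberField Manifold ContDiff MatrixGroups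
open NumberField Module Polynomial

namespace Literature.Geometry.Kaehler

namespace ComplexTorus

open Literature.NumberTheory.Automorphic (IsTorusSubgroup)
open Literature.AlgebraicGeometry.Motives (CMType HodgeTensorFacts)
open Literature.NumberTheory.ComplexMultiplication (IsCMAlgTorusRat)
open Literature.NumberTheory.ComplexMultiplication.CMTypeLattice (periodIso basisIndex card_basisIndex_eq_finrank
  isCMTorusRat_periodIso isAbelianVariety_periodIso isTotallyComplex_of_cmType)
-- `CMTypeLattice.mulMatrix I a` is spelled with its namespace below (the elliptic files in the import cone declare
-- a `ComplexTorus.mulMatrix` of their own).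
open Literature.NumberTheory.ComplexMultiplication (CMTypeLattice.mulMatrix)

/-! ### §1 `MT(ℂ^Φ/Φ(𝔞))` is a torus for every CM type; so is `MT(X)` for every `(X, u)` with `P_u = Φ_d` -/

section CMTorus

variable {K : Type} [Field K] [NumberField K]

/-- **THE MUMFORD–TATE GROUP OF `ℂ^Φ/Φ(𝔞)` IS AN ALGEBRAIC TORUS, FOR EVERY CM TYPE `Φ`** (primitive or not) of a
number field `K` carrying one, and every fractional ideal `𝔞`: `ℂ^Φ/Φ(𝔞)` has `K`-multiplication of full degree
(«`(A, ι)` of type `(F)` with `[F : ℚ] = 2n`»), i.e. it is of CM-type in Deligne's / Milne's sense, «and so its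
Mumford–Tate group is a torus». [cite: Shimura1998, §6.1 Thm. 2, p. 41] [cite: Deligne1982HodgeCycles, I §5, p. 63]
[cite: Milne2005ShimuraVarieties, §14 Def. 14.9 and Prop. 14.10 ((a) ⟹ (c))] [cite: Gordon1997, §2 Prop. 2.12 (⟹)] -/
theorem isTorusSubgroup_mumfordTateGroupC_periodIso (Φ : CMType K) (I : (FractionalIdeal (𝓞 K)⁰ K)ˣ) :
    IsTorusSubgroup (mumfordTateGroupC (periodIso Φ I)) :=
  (IsCMAlgTorusRat.of_isCMTorusRat (isCMTorusRat_periodIso Φ I)).isTorusSubgroup_mumfordTateGroupC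

/-- **The Hodge group of `ℂ^Φ/Φ(𝔞)` (read in `GL`) is an algebraic torus**, for every CM type `Φ`.
[cite: Gordon1997, §2 Prop. 2.12 (proof, ⟹)] [cite: Milne2005ShimuraVarieties, §14 Prop. 14.10 ((a) ⟹ (c))] -/
theorem isTorusSubgroup_map_toGL_hodgeGroupC_periodIso (Φ : CMType K) (I : (FractionalIdeal (𝓞 K)⁰ K)ˣ) :
    IsTorusSubgroup ((hodgeGroupC (periodIso Φ I)).map Matrix.SpecialLinearGroup.toGL) :=
  (IsCMAlgTorusRat.of_isCMTorusRat (isCMTorusRat_periodIso Φ I)).isTorusSubgroup_map_toGL_hodgeGroupC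

/-- **The Hodge group of `ℂ^Φ/Φ(𝔞)` is commutative**, for every CM type `Φ` («a torus is commutative»).
[cite: Gordon1997, §2 Prop. 2.12] [cite: BirkenhakeLange2004, §17.3] -/
theorem hodgeGroupC_comm_periodIso (Φ : CMType K) (I : (FractionalIdeal (𝓞 K)⁰ K)ˣ)
    {M N : Matrix.SpecialLinearGroup (basisIndex I) ℂ} (hM : M ∈ hodgeGroupC (periodIso Φ I))
    (hN : N ∈ hodgeGroupC (periodIso Φ I)) : M * N = N * M :=
  hodgeGroupC_comm_of_isTorusSubgroup _ (isTorusSubgroup_map_toGL_hodgeGroupC_periodIso Φ I) hM hN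

end CMTorus

section General

variable {ι : Type} [Fintype ι] [DecidableEq ι] {E : Type} [NormedAddCommGroup E] [NormedSpace ℂ E]
  {P : (ι → ℝ) ≃L[ℝ] E} {d : ℕ} [NeZero d]

set_option backward.isDefEq.respectTransparency false in -- Mathlib's instance
-- `IsCyclotomicExtension {d} ℚ (CyclotomicField d ℚ)` is keyed on `CyclotomicField.algebra`, the goal on
-- `DivisionRing.toRatAlgebra` (same workaround as generation 31 FILE 1 `isAbelianVariety_of_charpoly_eq_cyclotomic`)
/-- **THE MUMFORD–TATE GROUP OF A COMPLEX TORUS WITH AN ENDOMORPHISM OF CHARACTERISTIC POLYNOMIAL `Φ_d` IS AN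
ALGEBRAIC TORUS** — whatever the CM type of the model: `X ≅ ℂ^Φ/Φ(𝔞)` (structure theorem), `X` is an abelian
variety, «`MT` is a torus» is an isogeny invariant of abelian varieties («an isogeny is an isomorphism of Hodge
structures»), and `MT(ℂ^Φ/Φ(𝔞))` is a torus.  (Generation 31 FILE 13 `isTorusSubgroup_mumfordTateGroupC_of_iso`
assumed the model simple.) [cite: Shimura1998, §6.1 Thm. 2 p. 41, §6.2 Thm. 3 p. 42] [cite: Deligne1982HodgeCycles, I §5, p. 63]
[cite: Milne2005ShimuraVarieties, §14 Prop. 14.10] [cite: MoonenZarhin1999LowDim, (0.2)(4)] [cite: BirkenhakeLange2004, §13.3, §17.3] -/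
theorem isTorusSubgroup_mumfordTateGroupC_of_charpoly_eq_cyclotomic {A : Matrix ι ι ℤ} (hA : A ∈ endRingInt P)
    (hP : A.charpoly = cyclotomic d ℤ) : IsTorusSubgroup (mumfordTateGroupC P) := by
  have hζ₀ := IsCyclotomicExtension.zeta_spec d ℚ (CyclotomicField d ℚ)
  obtain ⟨Φ, I, e, he, he₂, -⟩ := exists_cmType_ideal_iso_of_charpoly_eq_cyclotomic hζ₀ hA hP
  have hX : IsAbelianVariety P := isAbelianVariety_of_charpoly_eq_cyclotomic hA hP
  have h : IsIsogenous P (periodIso Φ I) := IsIsomorphic.isIsogenous ⟨e, he, he₂⟩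
  rw [hX.isTorusSubgroup_mumfordTateGroupC_iff, h.exists_comm_isReduced_le_endAlgRat_iff hX,
    ← (h.isAbelianVariety_iff.1 hX).isTorusSubgroup_mumfordTateGroupC_iff]
  exact isTorusSubgroup_mumfordTateGroupC_periodIso Φ I

/-- **The Hodge group (in `GL`) of a complex torus with an endomorphism of characteristic polynomial `Φ_d` is an
algebraic torus.** [cite: Gordon1997, §2 Prop. 2.12] [cite: Milne2005ShimuraVarieties, §14 Prop. 14.10] -/
theorem isTorusSubgroup_map_toGL_hodgeGroupC_of_charpoly_eq_cyclotomic {A : Matrix ι ι ℤ} (hA : A ∈ endRingInt P)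
    (hP : A.charpoly = cyclotomic d ℤ) : IsTorusSubgroup ((hodgeGroupC P).map Matrix.SpecialLinearGroup.toGL) :=
  (isTorusSubgroup_mumfordTateGroupC_iff_map_toGL_hodgeGroupC P).1
    (isTorusSubgroup_mumfordTateGroupC_of_charpoly_eq_cyclotomic hA hP)

/-- **The Hodge group of a complex torus with an endomorphism of characteristic polynomial `Φ_d` is commutative**
(«of CM-type: its Mumford–Tate group is commutative»). [cite: Deligne1982HodgeCycles, I §5, p. 63] [cite: Gordon1997, §2 Prop. 2.12]
[cite: BirkenhakeLange2004, §17.3] -/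
theorem hodgeGroupC_comm_of_charpoly_eq_cyclotomic {A : Matrix ι ι ℤ} (hA : A ∈ endRingInt P)
    (hP : A.charpoly = cyclotomic d ℤ) {M N : Matrix.SpecialLinearGroup ι ℂ} (hM : M ∈ hodgeGroupC P)
    (hN : N ∈ hodgeGroupC P) : M * N = N * M :=
  hodgeGroupC_comm_of_isTorusSubgroup _ (isTorusSubgroup_map_toGL_hodgeGroupC_of_charpoly_eq_cyclotomic hA hP) hM hN

omit [NeZero d] in
/-- **Order form: a complex torus of dimension `φ(q)/2` with an endomorphism of prime-power order `q` has an algebraic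
torus as Mumford–Tate group** (`P_u = Φ_q`, FILE 2). [cite: BirkenhakeLange2004, §13.3] [cite: Deligne1982HodgeCycles, I §5, p. 63]
[cite: Milne2005ShimuraVarieties, §14 Prop. 14.10] -/
theorem isTorusSubgroup_mumfordTateGroupC_of_orderOf_eq {q : ℕ} {A : Matrix ι ι ℤ} (hA : A ∈ endRingInt P)
    (hq : IsPrimePow q) (hord : orderOf A = q) (hdim : 2 * finrank ℂ E = Nat.totient q) :
    IsTorusSubgroup (mumfordTateGroupC P) :=
  haveI : NeZero q := ⟨hq.pos.ne'⟩
  isTorusSubgroup_mumfordTateGroupC_of_charpoly_eq_cyclotomic hA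
    (charpoly_eq_cyclotomic_of_orderOf_eq_of_finrank P hq hord hdim)

omit [NeZero d] in
/-- … and a commutative Hodge group. [cite: Deligne1982HodgeCycles, I §5, p. 63] [cite: Gordon1997, §2 Prop. 2.12] -/
theorem hodgeGroupC_comm_of_orderOf_eq {q : ℕ} {A : Matrix ι ι ℤ} (hA : A ∈ endRingInt P) (hq : IsPrimePow q)
    (hord : orderOf A = q) (hdim : 2 * finrank ℂ E = Nat.totient q) {M N : Matrix.SpecialLinearGroup ι ℂ}
    (hM : M ∈ hodgeGroupC P) (hN : N ∈ hodgeGroupC P) : M * N = N * M :=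
  haveI : NeZero q := ⟨hq.pos.ne'⟩
  hodgeGroupC_comm_of_charpoly_eq_cyclotomic hA (charpoly_eq_cyclotomic_of_orderOf_eq_of_finrank P hq hord hdim) hM hN

end General

/-! ### §2 The `ζ_7`-threefolds -/

section Seven

variable {ι : Type} [Fintype ι] [DecidableEq ι] {E : Type} [NormedAddCommGroup E] [NormedSpace ℂ E]
  {P : (ι → ℝ) ≃L[ℝ] E}

/-- `7` is prime. [folklore] -/
private theorem prime_seven₃₂' : Nat.Prime 7 := Nat.prime_seven

/-- **The Mumford–Tate group of a `3`-dimensional complex torus with an endomorphism of order `7` is an algebraic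
torus** (simple or not: `X ≅ ℂ³/Φ(𝔞)` for `ℚ(ζ_7)` is of CM-type). [cite: Deligne1982HodgeCycles, I §5, p. 63]
[cite: Milne2005ShimuraVarieties, §14 Prop. 14.10] [cite: BirkenhakeLange2004, §13.3, §17.3] -/
theorem isTorusSubgroup_mumfordTateGroupC_of_orderOf_eq_seven {A : Matrix ι ι ℤ} (hA : A ∈ endRingInt P)
    (hord : orderOf A = 7) (hdim : finrank ℂ E = 3) : IsTorusSubgroup (mumfordTateGroupC P) :=
  isTorusSubgroup_mumfordTateGroupC_of_orderOf_eq hA prime_seven₃₂'.isPrimePow hord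
    (by rw [hdim, Nat.totient_prime prime_seven₃₂'])

/-- **The Hodge group of a `3`-dimensional complex torus with an endomorphism of order `7` is commutative.**
[cite: Deligne1982HodgeCycles, I §5, p. 63] [cite: Gordon1997, §2 Prop. 2.12] -/
theorem hodgeGroupC_comm_of_orderOf_eq_seven {A : Matrix ι ι ℤ} (hA : A ∈ endRingInt P) (hord : orderOf A = 7)
    (hdim : finrank ℂ E = 3) {M N : Matrix.SpecialLinearGroup ι ℂ} (hM : M ∈ hodgeGroupC P)
    (hN : N ∈ hodgeGroupC P) : M * N = N * M :=
  hodgeGroupC_comm_of_orderOf_eq hA prime_seven₃₂'.isPrimePow hord (by rw [hdim, Nat.totient_prime prime_seven₃₂']) hM hN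

set_option backward.isDefEq.respectTransparency false in -- Mathlib's instance
-- `IsCyclotomicExtension {7} ℚ (CyclotomicField 7 ℚ)` is keyed on `CyclotomicField.algebra`, the goal on
-- `DivisionRing.toRatAlgebra` (same workaround as generation 31 FILE 1 `isAbelianVariety_of_charpoly_eq_cyclotomic`)
/-- **`rank MT(X) = 4 = dim X + 1` FOR A SIMPLE `3`-TORUS WITH AN ENDOMORPHISM OF ORDER `7`** (a simple CM abelian
variety of prime dimension `3` is nondegenerate — Yanai). [cite: Yanai1985, §4 Theorem (p. 171)]
[cite: Gordon1999HodgeAVSurvey, Thm. 6.3 (2) and Remark] [cite: MoonenZarhin1999LowDim, Thm. 0.1 (4)] -/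
theorem mtRank_hodgeStructure_eq_four_of_orderOf_eq_seven [HodgeTensorFacts.{0, 0}] (hX : ComplexTorus.IsSimple P)
    {A : Matrix ι ι ℤ} (hA : A ∈ endRingInt P) (hord : orderOf A = 7) (hdim : finrank ℂ E = 3) :
    (hodgeStructure P 1).mtRank = 4 := by
  have hζ := IsCyclotomicExtension.zeta_spec 7 ℚ (CyclotomicField 7 ℚ)
  have hP := charpoly_eq_cyclotomic_seven_of_orderOf hord hdim P
  obtain ⟨Φ, I, e, he, he₂, -⟩ := exists_cmType_ideal_iso_of_charpoly_eq_cyclotomic hζ hA hP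
  exact mtRank_hodgeStructure_eq_of_iso_of_prime hA hP ((IsIsomorphic.isSimple_iff ⟨e, he, he₂⟩).1 hX) e he he₂
    Nat.prime_three (by rw [Nat.totient_prime prime_seven₃₂'])

set_option backward.isDefEq.respectTransparency false in -- see above
/-- **THE HODGE CLASSES ON EVERY POWER OF EVERY `3`-DIMENSIONAL COMPLEX TORUS WITH AN ENDOMORPHISM OF ORDER `7` ARE
GENERATED BY DIVISOR CLASSES**: `Hdg(X^k) = Div(X^k)` for all `k`.  Simple `X`: a simple CM abelian threefold —
prime dimension (Tankeev–Ribet, via Yanai's nondegeneracy; or Moonen–Zarhin `dim ≤ 3`).  Non-simple `X`: `X ∼ E³`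
with `E = ℂ/Φ₀(𝓞_{K₀})` a CM elliptic curve (`K₀ = ℚ(√−7) ⊂ ℚ(ζ_7)`); «`Hdg = Div` on all powers» is an isogeny
invariant and passes between `E` and `E³`, and it holds for the CM elliptic curve `E` (simple, of CM-type, `dim ≤ 3`).
[cite: MoonenZarhin1999LowDim, Thm. 0.1 (4) and (0.2)(4)] [cite: Gordon1999HodgeAVSurvey, Thm. 6.3 (2) and Remark, 7.6]
[cite: Lange2023AbelianVarietiesComplex, §7.3.3 Exercise (1)] [cite: BirkenhakeLange2004, §13.3] -/
theorem divisorClasses_powPeriod_eq_hodgeClasses_of_orderOf_eq_seven [HodgeTensorFacts.{0, 0}] {A : Matrix ι ι ℤ}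
    (hA : A ∈ endRingInt P) (hord : orderOf A = 7) (hdim : finrank ℂ E = 3) (k p : ℕ) :
    divisorClasses (powPeriod P k) p = hodgeClasses (powPeriod P k) p := by
  by_cases hX : ComplexTorus.IsSimple P
  · -- simple: prime dimension `3`
    have hζ := IsCyclotomicExtension.zeta_spec 7 ℚ (CyclotomicField 7 ℚ)
    have hP := charpoly_eq_cyclotomic_seven_of_orderOf hord hdim P
    obtain ⟨Φ, I, e, he, he₂, -⟩ := exists_cmType_ideal_iso_of_charpoly_eq_cyclotomic hζ hA hP
    exact divisorClasses_powPeriod_eq_hodgeClasses_of_iso_of_prime hA hP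
      ((IsIsomorphic.isSimple_iff ⟨e, he, he₂⟩).1 hX) e he he₂ Nat.prime_three
      (by rw [Nat.totient_prime prime_seven₃₂']) k p
  · -- non-simple: `X ∼ E³`
    obtain ⟨K₀, Φ₀, h2, hI⟩ := exists_isIsogenous_cube_of_orderOf_eq_seven hA hord hdim hX
    obtain ⟨hS₀, hiso⟩ := hI 1
    haveI : IsTotallyComplex K₀ := isTotallyComplex_of_cmType Φ₀
    haveI : Algebra.IsQuadraticExtension ℚ K₀ := { finrank_eq_two' := h2 }
    haveI : IsCMField K₀ := IsCMField.ofCMExtension ℚ K₀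
    have hY : IsAbelianVariety (periodIso Φ₀ 1) := isAbelianVariety_periodIso Φ₀ 1
    have hcard : Fintype.card (basisIndex (1 : (FractionalIdeal (𝓞 K₀)⁰ K₀)ˣ)) = 2 := by
      rw [card_basisIndex_eq_finrank, h2]
    haveI : Nonempty (basisIndex (1 : (FractionalIdeal (𝓞 K₀)⁰ K₀)ˣ)) := Fintype.card_pos_iff.1 (by omega)
    exact (forall_powPeriod_divisorClasses_eq_hodgeClasses_iff_of_isIsogenous_powPeriod hY three_pos hiso).2
      (fun k p ↦ hY.divisorClasses_powPeriod_eq_hodgeClasses_of_isSimple_of_card_le_six_of_isTorusSubgroup_mumfordTateGroupC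
        hS₀ (isTorusSubgroup_mumfordTateGroupC_periodIso Φ₀ 1) (by omega) k p) k p

set_option backward.isDefEq.respectTransparency false in -- see above
/-- **THE FINITE-ORDER ENDOMORPHISMS OF A SIMPLE `3`-TORUS WITH AN ENDOMORPHISM `u` OF ORDER `7` ARE THE FOURTEEN MAPS
`±u^r`** (`End_ℚ(X) = ℚ(ζ_7)`, whose roots of unity are `±ζ_7^r`; `7` odd). [cite: Shimura1998, §5.1 Prop. 6 p. 37, §8.2 Prop. 26 p. 69]
[cite: BirkenhakeLange2004, §13.3] -/
theorem exists_eq_pow_or_neg_pow_of_isOfFinOrder_seven (hX : ComplexTorus.IsSimple P) {A : Matrix ι ι ℤ}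
    (hA : A ∈ endRingInt P) (hord : orderOf A = 7) (hdim : finrank ℂ E = 3) {v : Matrix ι ι ℤ}
    (hv : v ∈ endRingInt P) (hfin : IsOfFinOrder v) : ∃ r < 7, v = A ^ r ∨ v = -(A ^ r) := by
  have hζ := IsCyclotomicExtension.zeta_spec 7 ℚ (CyclotomicField 7 ℚ)
  obtain ⟨Φ, I, e, he, he₂, hcomm⟩ :=
    exists_cmType_ideal_iso_of_charpoly_eq_cyclotomic hζ hA (charpoly_eq_cyclotomic_seven_of_orderOf hord hdim P)
  exact exists_eq_pow_or_neg_pow_of_isOfFinOrder_of_iso hζ (by decide) ((IsIsomorphic.isSimple_iff ⟨e, he, he₂⟩).1 hX)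
    e he he₂ hcomm hv hfin

set_option backward.isDefEq.respectTransparency false in -- see above
/-- **… so `v^{14} = 1` for every finite-order endomorphism** of a simple `ζ_7`-threefold. [cite: BirkenhakeLange2004, §13.3] -/
theorem pow_fourteen_eq_one_of_isOfFinOrder_seven (hX : ComplexTorus.IsSimple P) {A : Matrix ι ι ℤ}
    (hA : A ∈ endRingInt P) (hord : orderOf A = 7) (hdim : finrank ℂ E = 3) {v : Matrix ι ι ℤ}
    (hv : v ∈ endRingInt P) (hfin : IsOfFinOrder v) : v ^ 14 = 1 := by
  have hζ := IsCyclotomicExtension.zeta_spec 7 ℚ (CyclotomicField 7 ℚ)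
  have hP := charpoly_eq_cyclotomic_seven_of_orderOf hord hdim P
  obtain ⟨Φ, I, e, he, he₂, hcomm⟩ := exists_cmType_ideal_iso_of_charpoly_eq_cyclotomic hζ hA hP
  exact pow_two_mul_eq_one_of_isOfFinOrder_of_iso hζ (by decide) hP ((IsIsomorphic.isSimple_iff ⟨e, he, he₂⟩).1 hX)
    e he he₂ hcomm hv hfin

/-- **The orders of the finite-order endomorphisms of a simple `ζ_7`-threefold divide `14`** (they are `1, 2, 7, 14`:
no automorphism of order `3, 4, 5, 6, 8, 9, 10, 12`). [cite: BirkenhakeLange2004, §13.3] -/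
theorem orderOf_dvd_fourteen_of_isOfFinOrder_seven (hX : ComplexTorus.IsSimple P) {A : Matrix ι ι ℤ}
    (hA : A ∈ endRingInt P) (hord : orderOf A = 7) (hdim : finrank ℂ E = 3) {v : Matrix ι ι ℤ}
    (hv : v ∈ endRingInt P) (hfin : IsOfFinOrder v) : orderOf v ∣ 14 :=
  orderOf_dvd_of_pow_eq_one (pow_fourteen_eq_one_of_isOfFinOrder_seven hX hA hord hdim hv hfin)

set_option backward.isDefEq.respectTransparency false in -- see above
/-- **A SIMPLE `ζ_7`-THREEFOLD HAS EXACTLY FOURTEEN ENDOMORPHISMS OF FINITE ORDER** (the `±u^r`, pairwise distinct).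
[cite: Shimura1998, §5.1 Prop. 6, p. 37] [cite: BirkenhakeLange2004, §13.3] -/
theorem ncard_setOf_isOfFinOrder_seven (hX : ComplexTorus.IsSimple P) {A : Matrix ι ι ℤ} (hA : A ∈ endRingInt P)
    (hord : orderOf A = 7) (hdim : finrank ℂ E = 3) :
    {v : Matrix ι ι ℤ | v ∈ endRingInt P ∧ IsOfFinOrder v}.ncard = 14 := by
  have hζ := IsCyclotomicExtension.zeta_spec 7 ℚ (CyclotomicField 7 ℚ)
  have hP := charpoly_eq_cyclotomic_seven_of_orderOf hord hdim P
  obtain ⟨Φ, I, e, he, he₂, hcomm⟩ := exists_cmType_ideal_iso_of_charpoly_eq_cyclotomic hζ hA hP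
  exact ncard_setOf_isOfFinOrder_of_iso hζ (by decide) hA hP ((IsIsomorphic.isSimple_iff ⟨e, he, he₂⟩).1 hX)
    e he he₂ hcomm

end Seven

/-! ### §3 The `ζ_9`-threefolds -/

section Nine

variable {ι : Type} [Fintype ι] [DecidableEq ι] {E : Type} [NormedAddCommGroup E] [NormedSpace ℂ E]
  {P : (ι → ℝ) ≃L[ℝ] E}

/-- `9 = 3²` is a prime power. [folklore] -/
private theorem isPrimePow_nine₃₂' : IsPrimePow 9 :=
  (isPrimePow_nat_iff 9).2 ⟨3, 2, Nat.prime_three, by norm_num, by norm_num⟩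

/-- `φ(9) = 6`. [folklore] -/
private theorem totient_nine₃₂' : Nat.totient 9 = 6 := by decide

/-- **The Mumford–Tate group of a `3`-dimensional complex torus with an endomorphism of order `9` is an algebraic
torus** (simple or not). [cite: Deligne1982HodgeCycles, I §5, p. 63] [cite: Milne2005ShimuraVarieties, §14 Prop. 14.10]
[cite: BirkenhakeLange2004, §13.3, §17.3] -/
theorem isTorusSubgroup_mumfordTateGroupC_of_orderOf_eq_nine {A : Matrix ι ι ℤ} (hA : A ∈ endRingInt P)
    (hord : orderOf A = 9) (hdim : finrank ℂ E = 3) : IsTorusSubgroup (mumfordTateGroupC P) :=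
  isTorusSubgroup_mumfordTateGroupC_of_orderOf_eq hA isPrimePow_nine₃₂' hord (by rw [hdim, totient_nine₃₂'])

/-- **The Hodge group of a `3`-dimensional complex torus with an endomorphism of order `9` is commutative.**
[cite: Deligne1982HodgeCycles, I §5, p. 63] [cite: Gordon1997, §2 Prop. 2.12] -/
theorem hodgeGroupC_comm_of_orderOf_eq_nine {A : Matrix ι ι ℤ} (hA : A ∈ endRingInt P) (hord : orderOf A = 9)
    (hdim : finrank ℂ E = 3) {M N : Matrix.SpecialLinearGroup ι ℂ} (hM : M ∈ hodgeGroupC P)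
    (hN : N ∈ hodgeGroupC P) : M * N = N * M :=
  hodgeGroupC_comm_of_orderOf_eq hA isPrimePow_nine₃₂' hord (by rw [hdim, totient_nine₃₂']) hM hN

set_option backward.isDefEq.respectTransparency false in -- see §2
/-- **`rank MT(X) = 4 = dim X + 1` FOR A SIMPLE `3`-TORUS WITH AN ENDOMORPHISM OF ORDER `9`** (prime dimension `3`:
nondegenerate). [cite: Yanai1985, §4 Theorem (p. 171)] [cite: Gordon1999HodgeAVSurvey, Thm. 6.3 (2) and Remark]
[cite: MoonenZarhin1999LowDim, Thm. 0.1 (4)] -/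
theorem mtRank_hodgeStructure_eq_four_of_orderOf_eq_nine [HodgeTensorFacts.{0, 0}] (hX : ComplexTorus.IsSimple P)
    {A : Matrix ι ι ℤ} (hA : A ∈ endRingInt P) (hord : orderOf A = 9) (hdim : finrank ℂ E = 3) :
    (hodgeStructure P 1).mtRank = 4 := by
  have hζ := IsCyclotomicExtension.zeta_spec 9 ℚ (CyclotomicField 9 ℚ)
  have hP := charpoly_eq_cyclotomic_nine_of_orderOf hord hdim P
  obtain ⟨Φ, I, e, he, he₂, -⟩ := exists_cmType_ideal_iso_of_charpoly_eq_cyclotomic hζ hA hP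
  exact mtRank_hodgeStructure_eq_of_iso_of_prime hA hP ((IsIsomorphic.isSimple_iff ⟨e, he, he₂⟩).1 hX) e he he₂
    Nat.prime_three totient_nine₃₂'

set_option backward.isDefEq.respectTransparency false in -- see §2
/-- **THE HODGE CLASSES ON EVERY POWER OF EVERY `3`-DIMENSIONAL COMPLEX TORUS WITH AN ENDOMORPHISM OF ORDER `9` ARE
GENERATED BY DIVISOR CLASSES** (`Hdg(X^k) = Div(X^k)` for all `k`; simple: prime dimension `3`; non-simple:
`X ∼ E³` with `E` a CM elliptic curve of `ℚ(√−3)`). [cite: MoonenZarhin1999LowDim, Thm. 0.1 (4) and (0.2)(4)]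
[cite: Gordon1999HodgeAVSurvey, Thm. 6.3 (2) and Remark, 7.6] [cite: Lange2023AbelianVarietiesComplex, §7.3.3 Exercise (1)]
[cite: BirkenhakeLange2004, §13.3] -/
theorem divisorClasses_powPeriod_eq_hodgeClasses_of_orderOf_eq_nine [HodgeTensorFacts.{0, 0}] {A : Matrix ι ι ℤ}
    (hA : A ∈ endRingInt P) (hord : orderOf A = 9) (hdim : finrank ℂ E = 3) (k p : ℕ) :
    divisorClasses (powPeriod P k) p = hodgeClasses (powPeriod P k) p := by
  by_cases hX : ComplexTorus.IsSimple P
  · have hζ := IsCyclotomicExtension.zeta_spec 9 ℚ (CyclotomicField 9 ℚ)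
    have hP := charpoly_eq_cyclotomic_nine_of_orderOf hord hdim P
    obtain ⟨Φ, I, e, he, he₂, -⟩ := exists_cmType_ideal_iso_of_charpoly_eq_cyclotomic hζ hA hP
    exact divisorClasses_powPeriod_eq_hodgeClasses_of_iso_of_prime hA hP
      ((IsIsomorphic.isSimple_iff ⟨e, he, he₂⟩).1 hX) e he he₂ Nat.prime_three totient_nine₃₂' k p
  · obtain ⟨K₀, Φ₀, h2, hI⟩ := exists_isIsogenous_cube_of_orderOf_eq_nine hA hord hdim hX
    obtain ⟨hS₀, hiso⟩ := hI 1
    haveI : IsTotallyComplex K₀ := isTotallyComplex_of_cmType Φ₀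
    haveI : Algebra.IsQuadraticExtension ℚ K₀ := { finrank_eq_two' := h2 }
    haveI : IsCMField K₀ := IsCMField.ofCMExtension ℚ K₀
    have hY : IsAbelianVariety (periodIso Φ₀ 1) := isAbelianVariety_periodIso Φ₀ 1
    have hcard : Fintype.card (basisIndex (1 : (FractionalIdeal (𝓞 K₀)⁰ K₀)ˣ)) = 2 := by
      rw [card_basisIndex_eq_finrank, h2]
    haveI : Nonempty (basisIndex (1 : (FractionalIdeal (𝓞 K₀)⁰ K₀)ˣ)) := Fintype.card_pos_iff.1 (by omega)
    exact (forall_powPeriod_divisorClasses_eq_hodgeClasses_iff_of_isIsogenous_powPeriod hY three_pos hiso).2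
      (fun k p ↦ hY.divisorClasses_powPeriod_eq_hodgeClasses_of_isSimple_of_card_le_six_of_isTorusSubgroup_mumfordTateGroupC
        hS₀ (isTorusSubgroup_mumfordTateGroupC_periodIso Φ₀ 1) (by omega) k p) k p

set_option backward.isDefEq.respectTransparency false in -- see §2
/-- **THE FINITE-ORDER ENDOMORPHISMS OF A SIMPLE `3`-TORUS WITH AN ENDOMORPHISM `u` OF ORDER `9` ARE THE EIGHTEEN MAPS
`±u^r`** (`End_ℚ(X) = ℚ(ζ_9)`, roots of unity `±ζ_9^r`; `9` odd). [cite: Shimura1998, §5.1 Prop. 6 p. 37, §8.2 Prop. 26 p. 69]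
[cite: BirkenhakeLange2004, §13.3] -/
theorem exists_eq_pow_or_neg_pow_of_isOfFinOrder_nine (hX : ComplexTorus.IsSimple P) {A : Matrix ι ι ℤ}
    (hA : A ∈ endRingInt P) (hord : orderOf A = 9) (hdim : finrank ℂ E = 3) {v : Matrix ι ι ℤ}
    (hv : v ∈ endRingInt P) (hfin : IsOfFinOrder v) : ∃ r < 9, v = A ^ r ∨ v = -(A ^ r) := by
  have hζ := IsCyclotomicExtension.zeta_spec 9 ℚ (CyclotomicField 9 ℚ)
  obtain ⟨Φ, I, e, he, he₂, hcomm⟩ :=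
    exists_cmType_ideal_iso_of_charpoly_eq_cyclotomic hζ hA (charpoly_eq_cyclotomic_nine_of_orderOf hord hdim P)
  exact exists_eq_pow_or_neg_pow_of_isOfFinOrder_of_iso hζ (by decide) ((IsIsomorphic.isSimple_iff ⟨e, he, he₂⟩).1 hX)
    e he he₂ hcomm hv hfin

set_option backward.isDefEq.respectTransparency false in -- see §2
/-- **… so `v^{18} = 1` for every finite-order endomorphism** of a simple `ζ_9`-threefold. [cite: BirkenhakeLange2004, §13.3] -/
theorem pow_eighteen_eq_one_of_isOfFinOrder_nine (hX : ComplexTorus.IsSimple P) {A : Matrix ι ι ℤ}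
    (hA : A ∈ endRingInt P) (hord : orderOf A = 9) (hdim : finrank ℂ E = 3) {v : Matrix ι ι ℤ}
    (hv : v ∈ endRingInt P) (hfin : IsOfFinOrder v) : v ^ 18 = 1 := by
  have hζ := IsCyclotomicExtension.zeta_spec 9 ℚ (CyclotomicField 9 ℚ)
  have hP := charpoly_eq_cyclotomic_nine_of_orderOf hord hdim P
  obtain ⟨Φ, I, e, he, he₂, hcomm⟩ := exists_cmType_ideal_iso_of_charpoly_eq_cyclotomic hζ hA hP
  exact pow_two_mul_eq_one_of_isOfFinOrder_of_iso hζ (by decide) hP ((IsIsomorphic.isSimple_iff ⟨e, he, he₂⟩).1 hX)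
    e he he₂ hcomm hv hfin

/-- **The orders of the finite-order endomorphisms of a simple `ζ_9`-threefold divide `18`** (they are
`1, 2, 3, 6, 9, 18`). [cite: BirkenhakeLange2004, §13.3] -/
theorem orderOf_dvd_eighteen_of_isOfFinOrder_nine (hX : ComplexTorus.IsSimple P) {A : Matrix ι ι ℤ}
    (hA : A ∈ endRingInt P) (hord : orderOf A = 9) (hdim : finrank ℂ E = 3) {v : Matrix ι ι ℤ}
    (hv : v ∈ endRingInt P) (hfin : IsOfFinOrder v) : orderOf v ∣ 18 :=
  orderOf_dvd_of_pow_eq_one (pow_eighteen_eq_one_of_isOfFinOrder_nine hX hA hord hdim hv hfin)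

set_option backward.isDefEq.respectTransparency false in -- see §2
/-- **A SIMPLE `ζ_9`-THREEFOLD HAS EXACTLY EIGHTEEN ENDOMORPHISMS OF FINITE ORDER** (the `±u^r`).
[cite: Shimura1998, §5.1 Prop. 6, p. 37] [cite: BirkenhakeLange2004, §13.3] -/
theorem ncard_setOf_isOfFinOrder_nine (hX : ComplexTorus.IsSimple P) {A : Matrix ι ι ℤ} (hA : A ∈ endRingInt P)
    (hord : orderOf A = 9) (hdim : finrank ℂ E = 3) :
    {v : Matrix ι ι ℤ | v ∈ endRingInt P ∧ IsOfFinOrder v}.ncard = 18 := by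
  have hζ := IsCyclotomicExtension.zeta_spec 9 ℚ (CyclotomicField 9 ℚ)
  have hP := charpoly_eq_cyclotomic_nine_of_orderOf hord hdim P
  obtain ⟨Φ, I, e, he, he₂, hcomm⟩ := exists_cmType_ideal_iso_of_charpoly_eq_cyclotomic hζ hA hP
  exact ncard_setOf_isOfFinOrder_of_iso hζ (by decide) hA hP ((IsIsomorphic.isSimple_iff ⟨e, he, he₂⟩).1 hX)
    e he he₂ hcomm

end Nine

end ComplexTorus

end Literature.Geometry.Kaehler

end
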